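import Mathlib
import Literature.MathematicalPhysics.QuantumFieldTheory.Jegerlehner2017.SpectralFunctionInsertions
import Literature.Analysis.SpecialFunctions.DilogarithmRealArgument

/-!
# (R-IBP), part 1/3: the dilogarithm-free Källén–Sabry integrand `Φ(t,x)` — definitions, the pointwise
identity `ρ₄/W = q(D + ln((1+t)/2)·L) + p(T₂L + T₃ + T₄)`, and the derivatives `∂ₜP = q`, `∂ₜD = −S`
(venture QEDPrecision, cell `pub-qed`, integrator seat quad, gen 10)

HONEST FRAMING (verbatim, venture QEDPrecision): independent recomputation; certified where stated,
statistical where stated; no new-physics claim.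

The tenth-order subsets I(b), I(c) of the electron anomaly are typed (Literature, Jegerlehner 2017
(3.159)–(3.161): `setIbRep`, `setIcRep`) as iterated integrals whose inner factor is
`J₄(x) = ∫₀¹ ρ₄(t)/W_t(x) dt`, `ρ₄` = the Källén–Sabry two-loop spectral density in its printed
five-dilogarithm form (Jegerlehner (3.160), `rho4`) and `1/W_t(x) = x²(1−t²)/((2−x)² − x²t²)` (`wt`).
The cell's certified values of record for I(b), I(c) (certificate `certs/SetIbIc`, instrument B1′)
integrate NOT `ρ₄/W` but the dilogarithm-free function `Φ(t,x)` typed below (`phiIBP`), obtained from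
`ρ₄/W` by ONE integration by parts in `t` that trades every `Li₂` for logarithms (cell memo
`certs/SetIbIc/repr/R-IBP.md`: derived by computer algebra, re-derived by hand by both referees, checked
numerically to ≥ 43 digits, and until now labelled "NOT Lean-proved"). This file types `Φ` and its
printed ingredients `p, q, P, S, T₂, T₃, T₄` VERBATIM and proves the pointwise algebra and the two
derivative identities; part 2 (`KallenSabryPhiIntegrable`) proves interval-integrability on `[0,1]`;
part 3 (`KallenSabryIBP`) proves the representation identity `∫₀¹ ρ₄/W = ∫₀¹ Φ` and rewrites
`setIbRep`, `setIcRep` accordingly. NO numerical value is asserted anywhere.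
-/

noncomputable section

open Real Set MeasureTheory intervalIntegral

namespace Summit.Ventures.QEDPrecision.Integrands

open Literature.MathematicalPhysics.QuantumFieldTheory.Jegerlehner2017 (rho4 wt)
open Literature.Analysis.SpecialFunctions (realDilog reDilog realDilog_one reDilog_eq_realDilog
  hasDerivAt_reDilog)

/-! ## The printed ingredients of `Φ` (R-IBP.md, lines "p, q, P, S, T₂, T₃, T₄") -/

/-- `p(t,x) = 2tx²/(3((2−x)² − x²t²))` (`= (2t/(3(1−t²)))/W_t(x)`), regular on `[0,1]²∩{0<x<1}`.
[cell result: quad gen 8, certs/SetIbIc/repr/R-IBP.md] -/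
def ksP (x t : ℝ) : ℝ := 2 * t * x ^ 2 / (3 * ((2 - x) ^ 2 - x ^ 2 * t ^ 2))

/-- `q(t,x) = p(t,x)·(3−t²)(1+t²)/2`. [cell result: quad gen 8, certs/SetIbIc/repr/R-IBP.md] -/
def ksQ (x t : ℝ) : ℝ := ksP x t * ((3 - t ^ 2) * (1 + t ^ 2) / 2)

/-- `P(t,x) = ∫₀ᵗ q = (1/6)[t⁴/2 + (a²−2)t² + (a²−3)(a²+1)·ln(1 − t²/a²)]`, `a = (2−x)/x`.
[cell result: quad gen 8, certs/SetIbIc/repr/R-IBP.md] -/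
def ksPrim (x t : ℝ) : ℝ :=
  1 / 6 * (t ^ 4 / 2 + (((2 - x) / x) ^ 2 - 2) * t ^ 2
    + (((2 - x) / x) ^ 2 - 3) * (((2 - x) / x) ^ 2 + 1) * log (1 - t ^ 2 / ((2 - x) / x) ^ 2))

/-- `S(t) = −4ln(2t/(1+t))/(1−t²) + 2ln((1−t)/2)/(1+t) + 2ln((1+t)/2)/(1−t) − 2ln(1−t)/t + 2ln(1+t)/t`
(`= −∂ₜ` of the dilogarithm bracket). [cell result: quad gen 8, certs/SetIbIc/repr/R-IBP.md] -/
def ksS (t : ℝ) : ℝ :=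
  -4 * log (2 * t / (1 + t)) / (1 - t ^ 2) + 2 * log ((1 - t) / 2) / (1 + t)
    + 2 * log ((1 + t) / 2) / (1 - t) - 2 * log (1 - t) / t + 2 * log (1 + t) / t

/-- `T₂(t) = (11/16)(3−t²)(1+t²) + t⁴/4 − (3/2)t(3−t²)` (Jegerlehner (3.160)).
[cite: Jegerlehner2017, eq. (3.160)] -/
def ksT2 (t : ℝ) : ℝ := 11 / 16 * (3 - t ^ 2) * (1 + t ^ 2) + t ^ 4 / 4 - 3 / 2 * t * (3 - t ^ 2)

/-- `T₃(t) = t(3−t²)(3ln((1+t)/2) − 2ln t)` (Jegerlehner (3.160)). [cite: Jegerlehner2017, eq. (3.160)] -/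
def ksT3 (t : ℝ) : ℝ := t * (3 - t ^ 2) * (3 * log ((1 + t) / 2) - 2 * log t)

/-- `T₄(t) = (3/8)t(5−3t²)` (Jegerlehner (3.160)). [cite: Jegerlehner2017, eq. (3.160)] -/
def ksT4 (t : ℝ) : ℝ := 3 / 8 * t * (5 - 3 * t ^ 2)

/-- The dilogarithm-free integrand `Φ(t,x) = q·ln((1+t)/2)·ln((1+t)/(1−t)) + p·(T₂·ln((1+t)/(1−t)) +
T₃ + T₄) + P·S` of (R-IBP), VERBATIM. [cell result: quad gen 8, certs/SetIbIc/repr/R-IBP.md] -/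
def phiIBP (x t : ℝ) : ℝ :=
  ksQ x t * log ((1 + t) / 2) * log ((1 + t) / (1 - t))
    + ksP x t * (ksT2 t * log ((1 + t) / (1 - t)) + ksT3 t + ksT4 t) + ksPrim x t * ksS t

/-- The dilogarithm bracket of (3.160), `D(t) = ζ(2) + 2Li₂((1−t)/(1+t)) + 2Li₂((1+t)/2) − 2Li₂((1−t)/2)
− 4Li₂(t) + Li₂(t²)`, written with the integral dilogarithm `reDilog`. [cite: Jegerlehner2017, eq. (3.160)] -/
def ksD (t : ℝ) : ℝ :=
  π ^ 2 / 6 + 2 * reDilog ((1 - t) / (1 + t)) + 2 * reDilog ((1 + t) / 2) - 2 * reDilog ((1 - t) / 2)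
    - 4 * reDilog t + reDilog (t ^ 2)

/-! ## Pointwise algebra: `ρ₄/W = q(D + ln((1+t)/2)L) + p(T₂L + T₃ + T₄)` off `t = 1` -/

/-- For `0 < x < 1`, `0 ≤ t < 1`: `ρ₄(t)/W_t(x) = q·(D + ln((1+t)/2)·ln((1+t)/(1−t))) + p·(T₂·ln((1+t)/(1−t))
+ T₃ + T₄)` (the `(1−t²)` of `1/W` cancels the `1/(1−t²)` of (3.160)). [folklore] -/
theorem rho4_div_wt_eq_explicit {x t : ℝ} (hx0 : 0 < x) (hx1 : x < 1) (ht0 : 0 ≤ t) (ht1 : t < 1) :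
    rho4 t / wt t x 1
      = ksQ x t * (ksD t + log ((1 + t) / 2) * log ((1 + t) / (1 - t)))
        + ksP x t * (ksT2 t * log ((1 + t) / (1 - t)) + ksT3 t + ksT4 t) := by
  have ht2 : t ^ 2 < 1 := by nlinarith
  have h1t : (1:ℝ) - t ^ 2 ≠ 0 := by nlinarith
  have hx : x ≠ 0 := hx0.ne'
  have hx2 : 0 < x ^ 2 := by positivity
  have hxt : x ^ 2 * t ^ 2 < x ^ 2 := by nlinarith
  have hden : (2 - x) ^ 2 - x ^ 2 * t ^ 2 ≠ 0 := by nlinarith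
  -- the five dilogarithm arguments lie in `[0,1]`, where `realDilog = reDilog`
  have e1 : realDilog ((1 - t) / (1 + t)) = reDilog ((1 - t) / (1 + t)) :=
    (reDilog_eq_realDilog (by
      rw [abs_of_nonneg (div_nonneg (by linarith) (by linarith)), div_le_one (by linarith)]
      linarith)).symm
  have e2 : realDilog ((1 + t) / 2) = reDilog ((1 + t) / 2) :=
    (reDilog_eq_realDilog (by
      rw [abs_of_nonneg (div_nonneg (by linarith) (by norm_num)), div_le_one (by norm_num)]
      linarith)).symm
  have e3 : realDilog ((1 - t) / 2) = reDilog ((1 - t) / 2) :=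
    (reDilog_eq_realDilog (by
      rw [abs_of_nonneg (div_nonneg (by linarith) (by norm_num)), div_le_one (by norm_num)]
      linarith)).symm
  have e4 : realDilog t = reDilog t :=
    (reDilog_eq_realDilog (by rw [abs_of_nonneg ht0]; exact ht1.le)).symm
  have e5 : realDilog (t ^ 2) = reDilog (t ^ 2) :=
    (reDilog_eq_realDilog (by rw [abs_of_nonneg (by positivity)]; exact ht2.le)).symm
  have hW : wt t x 1 = ((2 - x) ^ 2 - x ^ 2 * t ^ 2) / ((1 - t ^ 2) * x ^ 2) := by
    unfold wt; field_simp; ring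
  have hp : 2 * t / (3 * (1 - t ^ 2)) / wt t x 1 = ksP x t := by
    rw [hW]; unfold ksP
    field_simp
  have hrho : rho4 t = 2 * t / (3 * (1 - t ^ 2)) *
      ((3 - t ^ 2) * (1 + t ^ 2) / 2 * (ksD t + log ((1 + t) / 2) * log ((1 + t) / (1 - t)))
        + (ksT2 t * log ((1 + t) / (1 - t)) + ksT3 t + ksT4 t)) := by
    unfold rho4 ksD ksT2 ksT3 ksT4
    rw [realDilog_one, e1, e2, e3, e4, e5]
    ring
  rw [hrho, mul_div_right_comm, hp]
  unfold ksQ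
  ring

/-! ## Derivatives: `∂ₜP = q` and `∂ₜD = −S` -/

/-- `∂ₜP(t,x) = q(t,x)` for `0 < x < 1`, `−1 ≤ t ≤ 1` (the numerator identity
`(t² + a² − 2)(a² − t²) − (a² − 3)(a² + 1) = (3 − t²)(1 + t²)`). [folklore] -/
theorem hasDerivAt_ksPrim {x t : ℝ} (hx0 : 0 < x) (hx1 : x < 1) (ht0 : -1 ≤ t) (ht1 : t ≤ 1) :
    HasDerivAt (fun t : ℝ => ksPrim x t) (ksQ x t) t := by
  unfold ksPrim ksQ ksP
  set a : ℝ := (2 - x) / x with ha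
  have hx : x ≠ 0 := hx0.ne'
  have ha1 : 1 < a := by
    rw [ha, lt_div_iff₀ hx0]; linarith
  have ha0 : a ≠ 0 := (by linarith : (0:ℝ) < a).ne'
  have ht2 : t ^ 2 ≤ 1 := by nlinarith
  have hat : 0 < a ^ 2 - t ^ 2 := by nlinarith
  have harg : 0 < 1 - t ^ 2 / a ^ 2 := by
    rw [one_sub_div (pow_ne_zero 2 ha0)]
    exact div_pos hat (pow_pos (by linarith) 2)
  have hin : HasDerivAt (fun t : ℝ => 1 - t ^ 2 / a ^ 2) (-(↑2 * t ^ (2 - 1) / a ^ 2)) t :=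
    ((hasDerivAt_pow 2 t).div_const (a ^ 2)).const_sub 1
  have hlog : HasDerivAt (fun t : ℝ => log (1 - t ^ 2 / a ^ 2))
      ((-(↑2 * t ^ (2 - 1) / a ^ 2)) / (1 - t ^ 2 / a ^ 2)) t := hin.log harg.ne'
  have hsum : HasDerivAt (fun t : ℝ => 1 / 6 * (t ^ 4 / 2 + (a ^ 2 - 2) * t ^ 2
        + (a ^ 2 - 3) * (a ^ 2 + 1) * log (1 - t ^ 2 / a ^ 2)))
      (1 / 6 * (↑4 * t ^ (4 - 1) / 2 + (a ^ 2 - 2) * (↑2 * t ^ (2 - 1))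
        + (a ^ 2 - 3) * (a ^ 2 + 1) * ((-(↑2 * t ^ (2 - 1) / a ^ 2)) / (1 - t ^ 2 / a ^ 2)))) t :=
    ((((hasDerivAt_pow 4 t).div_const 2).add ((hasDerivAt_pow 2 t).const_mul (a ^ 2 - 2))).add
      (hlog.const_mul ((a ^ 2 - 3) * (a ^ 2 + 1)))).const_mul (1 / 6)
  refine hsum.congr_deriv ?_
  have hD : (2 - x) ^ 2 - x ^ 2 * t ^ 2 = x ^ 2 * (a ^ 2 - t ^ 2) := by
    rw [ha]; field_simp
  rw [hD]
  have hat' : a ^ 2 - t ^ 2 ≠ 0 := hat.ne'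
  have harg' : 1 - t ^ 2 / a ^ 2 ≠ 0 := harg.ne'
  simp only [show (4 : ℕ) - 1 = 3 from rfl, show (2 : ℕ) - 1 = 1 from rfl, pow_one]
  field_simp
  ring

/-- `∂ₜ Li₂((1−t)/(1+t)) = 2ln(2t/(1+t))/(1−t²)` on `(0,1)`. [folklore] -/
theorem hasDerivAt_reDilog_moebius {t : ℝ} (ht0 : 0 < t) (ht1 : t < 1) :
    HasDerivAt (fun t : ℝ => reDilog ((1 - t) / (1 + t)))
      (2 * log (2 * t / (1 + t)) / (1 - t ^ 2)) t := by
  have h1p : 0 < 1 + t := by linarith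
  have h1m : 0 < 1 - t := by linarith
  have h1p' : 1 + t ≠ 0 := h1p.ne'
  have h1m' : 1 - t ≠ 0 := h1m.ne'
  have h1t2 : (1:ℝ) - t ^ 2 ≠ 0 := by nlinarith
  have hz : HasDerivAt (fun t : ℝ => (1 - t) / (1 + t))
      (((-1) * (1 + t) - (1 - t) * 1) / (1 + t) ^ 2) t := by
    have ha : HasDerivAt (fun t : ℝ => 1 - t) (-1) t := by
      simpa using (hasDerivAt_id t).const_sub 1
    have hb : HasDerivAt (fun t : ℝ => 1 + t) 1 t := by
      simpa using (hasDerivAt_id t).const_add 1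
    exact ha.div hb h1p.ne'
  have hz0 : (1 - t) / (1 + t) ≠ 0 := (div_pos h1m h1p).ne'
  have hz1 : (1 - t) / (1 + t) ≠ 1 := by
    intro h
    rw [div_eq_iff h1p.ne'] at h
    linarith
  have h := (hasDerivAt_reDilog hz0 hz1).comp t hz
  refine h.congr_deriv ?_
  have e1 : (1:ℝ) - (1 - t) / (1 + t) = 2 * t / (1 + t) := by
    field_simp; ring
  rw [e1]
  set L : ℝ := log (2 * t / (1 + t)) with hL
  field_simp
  ring

/-- `∂ₜ Li₂((1+t)/2) = −ln((1−t)/2)/(1+t)` on `(0,1)`. [folklore] -/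
theorem hasDerivAt_reDilog_half_add {t : ℝ} (ht0 : 0 < t) (ht1 : t < 1) :
    HasDerivAt (fun t : ℝ => reDilog ((1 + t) / 2)) (-(log ((1 - t) / 2) / (1 + t))) t := by
  have h1p : 0 < 1 + t := by linarith
  have h1p' : 1 + t ≠ 0 := h1p.ne'
  have hz : HasDerivAt (fun t : ℝ => (1 + t) / 2) ((1:ℝ) / 2) t := by
    simpa using ((hasDerivAt_id t).const_add 1).div_const 2
  have hz0 : (1 + t) / 2 ≠ 0 := (div_pos h1p two_pos).ne'
  have hz1 : (1 + t) / 2 ≠ 1 := by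
    intro h; linarith
  have h := (hasDerivAt_reDilog hz0 hz1).comp t hz
  refine h.congr_deriv ?_
  have e1 : (1:ℝ) - (1 + t) / 2 = (1 - t) / 2 := by ring
  rw [e1]
  set L : ℝ := log ((1 - t) / 2) with hL
  field_simp

/-- `∂ₜ Li₂((1−t)/2) = ln((1+t)/2)/(1−t)` on `(0,1)`. [folklore] -/
theorem hasDerivAt_reDilog_half_sub {t : ℝ} (ht0 : 0 < t) (ht1 : t < 1) :
    HasDerivAt (fun t : ℝ => reDilog ((1 - t) / 2)) (log ((1 + t) / 2) / (1 - t)) t := by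
  have h1m : 0 < 1 - t := by linarith
  have h1m' : 1 - t ≠ 0 := h1m.ne'
  have hz : HasDerivAt (fun t : ℝ => (1 - t) / 2) ((-1:ℝ) / 2) t := by
    simpa using ((hasDerivAt_id t).const_sub 1).div_const 2
  have hz0 : (1 - t) / 2 ≠ 0 := (div_pos h1m two_pos).ne'
  have hz1 : (1 - t) / 2 ≠ 1 := by
    intro h; linarith
  have h := (hasDerivAt_reDilog hz0 hz1).comp t hz
  refine h.congr_deriv ?_
  have e1 : (1:ℝ) - (1 - t) / 2 = (1 + t) / 2 := by ring
  rw [e1]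
  set L : ℝ := log ((1 + t) / 2) with hL
  field_simp

/-- `∂ₜ Li₂(t²) = −2(ln(1−t) + ln(1+t))/t` on `(0,1)`. [folklore] -/
theorem hasDerivAt_reDilog_sq {t : ℝ} (ht0 : 0 < t) (ht1 : t < 1) :
    HasDerivAt (fun t : ℝ => reDilog (t ^ 2)) (-(2 * (log (1 - t) + log (1 + t)) / t)) t := by
  have hz : HasDerivAt (fun t : ℝ => t ^ 2) (↑2 * t ^ (2 - 1)) t := hasDerivAt_pow 2 t
  have ht2 : t ^ 2 < 1 := by nlinarith
  have hz0 : t ^ 2 ≠ 0 := by positivity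
  have hz1 : t ^ 2 ≠ 1 := ht2.ne
  have h := (hasDerivAt_reDilog hz0 hz1).comp (h := fun t : ℝ => t ^ 2) t hz
  refine h.congr_deriv ?_
  have e1 : log (1 - t ^ 2) = log (1 - t) + log (1 + t) := by
    rw [show (1:ℝ) - t ^ 2 = (1 - t) * (1 + t) by ring]
    exact Real.log_mul (by linarith) (by linarith)
  rw [e1]
  have ht : t ≠ 0 := ht0.ne'
  set L : ℝ := log (1 - t) + log (1 + t) with hL
  simp only [show (2 : ℕ) - 1 = 1 from rfl, pow_one]
  field_simp

/-- `∂ₜD(t) = −S(t)` on `(0,1)`. [folklore] -/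
theorem hasDerivAt_ksD {t : ℝ} (ht0 : 0 < t) (ht1 : t < 1) :
    HasDerivAt (fun t : ℝ => ksD t) (-ksS t) t := by
  have h1 := hasDerivAt_reDilog_moebius ht0 ht1
  have h2 := hasDerivAt_reDilog_half_add ht0 ht1
  have h3 := hasDerivAt_reDilog_half_sub ht0 ht1
  have h4 : HasDerivAt (fun t : ℝ => reDilog t) (-(log (1 - t) / t)) t :=
    hasDerivAt_reDilog ht0.ne' ht1.ne
  have h5 := hasDerivAt_reDilog_sq ht0 ht1
  have h := (((((hasDerivAt_const t (π ^ 2 / 6)).add (h1.const_mul 2)).add (h2.const_mul 2)).sub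
    (h3.const_mul 2)).sub (h4.const_mul 4)).add h5
  unfold ksD ksS
  refine h.congr_deriv ?_
  ring

end Summit.Ventures.QEDPrecision.Integrands

end
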